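import Summits.QuantumAdvantage.AdviceFreeQNC0.CubeDistributions
import Summits.QuantumAdvantage.AdviceFreeQNC0.ProductGame
import Summits.QuantumAdvantage.AdviceFreeQNC0.DualDistanceCount
import HarnessLib

/-!
# Cell qa-qnc0 (rung F-Q1, fence F9-V): the fail family `𝓕_M(D)` as a coset in the `2^M`-cube —
# non-emptiness, triple-sum closure, DUAL DISTANCE `2^{D+1}`, and its cardinality

For the kernel form of FENCE F9-V (`ViolaFence.lean`, ask P-10V; Sketch10 `L3`, `L6`).  Rows
`(Fin M → Bool) → Bool` are encoded as points of the cube `Fin N → Bool`, `N = #(Fin M → Bool)`, through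
`Fintype.equivFin` (the indexing of `RowDeg`): `toRow`, `ofRow`.  `failSetW M D` = the fail patterns
`IsElimFail D` (`ProductGame.lean`) as a finite set of points.

* `failSetW_nonempty` (the all-`true` row, `isElimFail_true`), `failSetW_tripleClosed` (`isElimFail_xor3`):
  a coset of a linear code;
* **`parityBias_failSetW_eq_zero`** — every non-zero parity of weight `< 2^{D+1}` is BALANCED on `𝓕_M(D)`:
  if it were constant (the only alternative on a coset, `CubeDistr.coset_chi_dichotomy`), the set
  `{z : a_z = 1, |z| ≢ σ (3)}` (nonempty for `σ = 0` or `2`, of size `< 2^{D+1}`) would annihilate every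
  polynomial of degree `≤ D` — against the dual-distance count `two_pow_succ_le_card_of_sum_lowDeg_eq_zero`
  — because the class-`0` eliminator with stakes `(g, 0)` (resp. `(0, g)`) WINS exactly on
  `{|z| ≢ 0 (3), g(z) = 1}` (resp. `{|z| ≢ 2 (3), g(z) = 1}`);
* `card_failSetW_le` — `|𝓕_M(D)| ≤ 4^{ι(M,D)}`, `ι(M,D) = #{S ⊆ Fin M : |S| ≤ D} ≤ (D+1)(M+1)^D`
  (class-`0` normal form `isElimFail_class0`; `lowDeg` is spanned by `ι(M,D)` monomials).

All [folklore] / the cell's bookkeeping.  WHAT THIS IS NOT: nothing on α; separation NOT moved.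
-/

noncomputable section

namespace Summit.QuantumAdvantage.AdviceFreeQNC0

namespace CubeDistr

open Finset
open Literature.Computability.Complexity.SmallBiasXor
open Literature.Computability.MetaComplexity Literature.Computability.MetaComplexity.Smolensky

/-! ### Rows as points of the `2^M`-cube -/

/-- The number of row coordinates `N = #(Fin M → Bool)`. -/
abbrev RN (M : ℕ) : ℕ := Fintype.card (Fin M → Bool)

/-- `N = 2^M`. -/
theorem RN_eq (M : ℕ) : RN M = 2 ^ M := by
  rw [RN, Fintype.card_fun, Fintype.card_bool, Fintype.card_fin]

variable {M : ℕ}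

/-- The row encoded by a point of the `N`-cube (the `RowDeg` indexing). -/
def toRow (W : Fin (RN M) → Bool) : (Fin M → Bool) → Bool :=
  fun z => W (Fintype.equivFin (Fin M → Bool) z)

/-- The point of the `N`-cube encoding a row. -/
def ofRow (F : (Fin M → Bool) → Bool) : Fin (RN M) → Bool :=
  fun i => F ((Fintype.equivFin (Fin M → Bool)).symm i)

/-- `toRow ∘ ofRow = id`. -/
theorem toRow_ofRow (F : (Fin M → Bool) → Bool) : toRow (ofRow F) = F := by
  funext z; simp [toRow, ofRow]

/-- `ofRow ∘ toRow = id`. -/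
theorem ofRow_toRow (W : Fin (RN M) → Bool) : ofRow (toRow W) = W := by
  funext i; simp [toRow, ofRow]

/-- Counting through the encoding. -/
theorem card_filter_enc (p : Fin (RN M) → Prop) [DecidablePred p] :
    (univ.filter fun z : Fin M → Bool => p (Fintype.equivFin (Fin M → Bool) z)).card =
      (univ.filter p).card := by
  rw [← Finset.card_map (Fintype.equivFin (Fin M → Bool)).toEmbedding]
  congr 1
  ext i
  simp only [Finset.mem_map_equiv, Finset.mem_filter, Finset.mem_univ, true_and, Equiv.apply_symm_apply]

/-- The weight of a point is the number of `true`s of its row. -/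
theorem hw_eq_card_toRow (a : Fin (RN M) → Bool) :
    hw a = (univ.filter fun z : Fin M → Bool => toRow a z = true).card := by
  unfold hw toRow
  exact (card_filter_enc (fun i => a i = true)).symm

/-- The character exponent through the encoding. -/
theorem card_and_ofRow (a : Fin (RN M) → Bool) (G : (Fin M → Bool) → Bool) :
    (univ.filter fun i : Fin (RN M) => (a i && ofRow G i) = true).card =
      (univ.filter fun z : Fin M → Bool => toRow a z = true ∧ G z = true).card := by
  rw [← card_filter_enc (fun i : Fin (RN M) => (a i && ofRow G i) = true)]
  congr 1
  ext z
  simp only [Finset.mem_filter, Finset.mem_univ, true_and, ofRow, Equiv.symm_apply_apply, Bool.and_eq_true, toRow]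

/-! ### The fail family -/

open Classical in
/-- The fail family `𝓕_M(D)` (`IsElimFail D`) as a set of points of the `N`-cube. -/
def failSetW (M D : ℕ) : Finset (Fin (RN M) → Bool) :=
  univ.filter fun W : Fin (RN M) → Bool => IsElimFail D (toRow W)

variable {D : ℕ}

/-- Membership. -/
theorem mem_failSetW {W : Fin (RN M) → Bool} : W ∈ failSetW M D ↔ IsElimFail D (toRow W) := by
  classical
  unfold failSetW
  simp only [Finset.mem_filter, Finset.mem_univ, true_and]

/-- Fail patterns are members. -/
theorem ofRow_mem_failSetW {F : (Fin M → Bool) → Bool} (hF : IsElimFail D F) : ofRow F ∈ failSetW M D := by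
  rw [mem_failSetW, toRow_ofRow]; exact hF

/-- `𝓕_M(D)` is nonempty (the all-`true` row). -/
theorem failSetW_nonempty (M D : ℕ) : (failSetW M D).Nonempty :=
  ⟨_, ofRow_mem_failSetW (isElimFail_true D)⟩

/-- `𝓕_M(D)` is closed under triple sums (`isElimFail_xor3`). -/
theorem failSetW_tripleClosed (M D : ℕ) : TripleClosed (failSetW M D) := by
  intro x hx y hy z hz
  rw [mem_failSetW] at hx hy hz ⊢
  exact isElimFail_xor3 hx hy hz

/-! ### The dual distance -/

/-- The class-`0` eliminator with one-sided stakes wins exactly where the stake is `1` outside one residue: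
stakes `(g, 0)` win on `{|v| ≢ 0, g v}`, stakes `(0, g)` on `{|v| ≢ 2, g v}`. -/
theorem exists_fail_win_iff (σ : ℕ) (hσ : σ = 0 ∨ σ = 2) {g : (Fin M → Bool) → Bool} (hg : HasDeg g D) :
    ∃ F : (Fin M → Bool) → Bool, IsElimFail D F ∧ ∀ v, F v = false ↔ (wt v % 3 ≠ σ ∧ g v = true) := by
  have key : ∀ t : ℕ, t < 3 → ∀ β : Bool,
      (elimFailBits 0 β false t = false ↔ (t ≠ 0 ∧ β = true)) ∧
        (elimFailBits 0 false β t = false ↔ (t ≠ 2 ∧ β = true)) := by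
    intro t ht β
    interval_cases t <;> cases β <;> decide
  rcases hσ with rfl | rfl
  · refine ⟨elimFail 0 g (fun _ => false), ⟨0, g, fun _ => false, hg, hasDeg_false D, fun v => rfl⟩, fun v => ?_⟩
    unfold elimFail
    rw [elimFailBits_mod, Nat.zero_mod]
    have h := (key (wt v % 3) (Nat.mod_lt _ (by norm_num)) (g v)).1
    rw [h]
  · refine ⟨elimFail 0 (fun _ => false) g, ⟨0, fun _ => false, g, hasDeg_false D, hg, fun v => rfl⟩, fun v => ?_⟩
    unfold elimFail
    rw [elimFailBits_mod, Nat.zero_mod]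
    have h := (key (wt v % 3) (Nat.mod_lt _ (by norm_num)) (g v)).2
    rw [h]

/-- **Dual distance of the fail family**: every non-zero parity of weight `< 2^{D+1}` is balanced on
`𝓕_M(D)` (Sketch10 `L3`). -/
theorem parityBias_failSetW_eq_zero {a : Fin (RN M) → Bool} (ha : a ≠ fun _ => false)
    (hwa : hw a < 2 ^ (D + 1)) : parityBias (unifOn (failSetW M D)) a = 0 := by
  classical
  rcases coset_chi_dichotomy (failSetW_tripleClosed M D) a with hbal | hconst
  · rw [parityBias_unifOn, hbal, zero_div]
  exfalso
  -- a point where the row `A = toRow a` is `true`, and the residue it avoids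
  obtain ⟨i, hi⟩ : ∃ i, a i = true := by
    by_contra h
    push Not at h
    exact ha (funext fun i => by simpa using h i)
  set z₀ : Fin M → Bool := (Fintype.equivFin (Fin M → Bool)).symm i with hz₀
  have hAz₀ : toRow a z₀ = true := by simp [toRow, hz₀, hi]
  obtain ⟨σ, hσ, hσz⟩ : ∃ σ : ℕ, (σ = 0 ∨ σ = 2) ∧ wt z₀ % 3 ≠ σ := by
    by_cases h0 : wt z₀ % 3 = 0
    · exact ⟨2, Or.inr rfl, by omega⟩
    · exact ⟨0, Or.inl rfl, h0⟩
  -- the annihilator candidate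
  set T := univ.filter fun z : Fin M → Bool => toRow a z = true ∧ wt z % 3 ≠ σ with hT
  have hTne : T.Nonempty := ⟨z₀, by rw [hT, Finset.mem_filter]; exact ⟨Finset.mem_univ _, hAz₀, hσz⟩⟩
  have hTcard : T.card < 2 ^ (D + 1) := by
    refine lt_of_le_of_lt ?_ hwa
    rw [hw_eq_card_toRow]
    exact Finset.card_le_card fun z hz => by
      rw [hT, Finset.mem_filter] at hz; rw [Finset.mem_filter]; exact ⟨hz.1, hz.2.1⟩
  -- so some degree-`≤ D` polynomial does not sum to zero on `T`
  obtain ⟨g, hg, hgsum⟩ : ∃ g ∈ lowDeg (ZMod 2) M D, ∑ z ∈ T, g z ≠ 0 := by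
    by_contra h
    push Not at h
    have := two_pow_succ_le_card_of_sum_lowDeg_eq_zero D T hTne h
    omega
  -- its Boolean version and the eliminator winning exactly on `T ∩ {g = 1}`
  have h01 : ∀ y : ZMod 2, y = 0 ∨ y = 1 := by decide
  set gB : (Fin M → Bool) → Bool := fun z => decide (g z = 1) with hgB
  have hgBdeg : HasDeg gB D := by
    unfold HasDeg
    have heq : (fun x => if gB x = true then (1 : ZMod 2) else 0) = g := by
      funext x
      rcases h01 (g x) with h | h <;> simp [hgB, h]
    rw [heq]; exact hg
  obtain ⟨F, hF, hFwin⟩ := exists_fail_win_iff σ hσ hgBdeg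
  -- the two members `𝟙` and `F` of the coset, and the character on their difference
  have h1 : ofRow (fun _ : Fin M → Bool => true) ∈ failSetW M D := ofRow_mem_failSetW (isElimFail_true D)
  have h2 : ofRow F ∈ failSetW M D := ofRow_mem_failSetW hF
  have hprod : chi a (bxor (ofRow (fun _ : Fin M → Bool => true)) (ofRow F)) = 1 := by
    rw [chi_bxor, hconst _ h1 _ h2, chi_sq]
  -- but that difference is the WIN pattern, on which the character is `−1`
  have hdiff : bxor (ofRow (fun _ : Fin M → Bool => true)) (ofRow F) = ofRow (fun v => !F v) := by
    funext j; simp [bxor, ofRow]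
  have hcount : (univ.filter fun j : Fin (RN M) => (a j && ofRow (fun v => !F v) j) = true).card =
      (T.filter fun z => g z = 1).card := by
    rw [card_and_ofRow]
    congr 1
    ext z
    simp only [hT, Finset.mem_filter, Finset.mem_univ, true_and, Bool.not_eq_true']
    rw [hFwin z]
    simp [hgB]
    tauto
  have hodd : (T.filter fun z => g z = 1).card % 2 = 1 := by
    have hsum : ∑ z ∈ T, g z = ((T.filter fun z => g z = 1).card : ZMod 2) := by
      rw [← Finset.sum_boole]
      exact Finset.sum_congr rfl fun z _ => by rcases h01 (g z) with h | h <;> simp [h]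
    rw [hsum] at hgsum
    have : ¬ Even (T.filter fun z => g z = 1).card := fun hev =>
      hgsum ((ZMod.natCast_eq_zero_iff_even).2 hev)
    exact Nat.odd_iff.1 (Nat.not_even_iff_odd.1 this)
  have hneg : chi a (ofRow (fun v => !F v)) = -1 := by
    unfold chi
    rw [hcount, if_neg (by omega)]
  rw [hdiff, hneg] at hprod
  norm_num at hprod

/-! ### Cardinality of the fail family -/

/-- The number of multilinear monomials of degree `≤ D` in `M` variables. -/
def monoCount (M D : ℕ) : ℕ := Fintype.card {S : Finset (Fin M) // S.card ≤ D}

/-- `ι(M,D) ≤ (D+1)·(M+1)^D`. -/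
theorem monoCount_le (M D : ℕ) : monoCount M D ≤ (D + 1) * (M + 1) ^ D := by
  classical
  unfold monoCount
  rw [Fintype.card_subtype]
  have hsub : (univ.filter fun S : Finset (Fin M) => S.card ≤ D) ⊆
      (Finset.range (D + 1)).biUnion fun j => Finset.powersetCard j (univ : Finset (Fin M)) := by
    intro S hS
    rw [Finset.mem_filter] at hS
    rw [Finset.mem_biUnion]
    exact ⟨S.card, Finset.mem_range.2 (by omega), Finset.mem_powersetCard.2 ⟨Finset.subset_univ _, rfl⟩⟩
  refine le_trans (Finset.card_le_card hsub) (le_trans Finset.card_biUnion_le ?_)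
  calc ∑ j ∈ Finset.range (D + 1), (Finset.powersetCard j (univ : Finset (Fin M))).card
      ≤ ∑ _j ∈ Finset.range (D + 1), (M + 1) ^ D := by
        refine Finset.sum_le_sum fun j hj => ?_
        rw [Finset.card_powersetCard, Finset.card_univ, Fintype.card_fin]
        have hjD : j ≤ D := by rw [Finset.mem_range] at hj; omega
        calc M.choose j ≤ M ^ j := Nat.choose_le_pow M j
          _ ≤ (M + 1) ^ j := Nat.pow_le_pow_left (by omega) j
          _ ≤ (M + 1) ^ D := Nat.pow_le_pow_right (by omega) hjD
    _ = (D + 1) * (M + 1) ^ D := by rw [Finset.sum_const, Finset.card_range, smul_eq_mul]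

/-- `|lowDeg(M, D)| ≤ 2^{ι(M,D)}` (every element is a combination of the `ι(M,D)` monomials). -/
theorem card_lowDeg_le (M D : ℕ) (L : Finset (CubeFn (ZMod 2) M))
    (hL : ∀ g ∈ L, g ∈ lowDeg (ZMod 2) M D) : L.card ≤ 2 ^ monoCount M D := by
  classical
  have hsub : L ⊆ (univ : Finset ({S : Finset (Fin M) // S.card ≤ D} → ZMod 2)).image
      fun c => ∑ S, c S • mono (ZMod 2) S.1 := by
    intro g hg
    have hg' := hL g hg
    rw [lowDeg_eq_span, Submodule.mem_span_range_iff_exists_fun] at hg'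
    obtain ⟨c, hc⟩ := hg'
    exact Finset.mem_image.2 ⟨c, Finset.mem_univ _, hc⟩
  refine le_trans (Finset.card_le_card hsub) (le_trans Finset.card_image_le ?_)
  rw [Finset.card_univ, Fintype.card_fun, ZMod.card]
  rfl

/-- **Cardinality of the fail family**: `|𝓕_M(D)| ≤ 4^{ι(M,D)}` (class-`0` normal form: a fail pattern is
determined by a pair of degree-`≤ D` polynomials). -/
theorem card_failSetW_le (M D : ℕ) : (failSetW M D).card ≤ 4 ^ monoCount M D := by
  classical
  set L : Finset (CubeFn (ZMod 2) M) := univ.filter fun g => g ∈ lowDeg (ZMod 2) M D with hLdef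
  have hL : ∀ g ∈ L, g ∈ lowDeg (ZMod 2) M D := fun g hg => (Finset.mem_filter.1 hg).2
  -- the class-`0` parametrisation
  set Φ : CubeFn (ZMod 2) M × CubeFn (ZMod 2) M → (Fin (RN M) → Bool) :=
    fun gg => ofRow (elimFail 0 (fun v => decide (gg.1 v = 1)) (fun v => decide (gg.2 v = 1))) with hΦ
  have hsub : failSetW M D ⊆ (L ×ˢ L).image Φ := by
    intro W hW
    rw [mem_failSetW] at hW
    obtain ⟨a', b', ha', hb', hrepr⟩ := isElimFail_class0 hW
    refine Finset.mem_image.2 ⟨(fun v => if a' v = true then 1 else 0, fun v => if b' v = true then 1 else 0),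
      Finset.mem_product.2 ⟨Finset.mem_filter.2 ⟨Finset.mem_univ _, ha'⟩,
        Finset.mem_filter.2 ⟨Finset.mem_univ _, hb'⟩⟩, ?_⟩
    rw [← ofRow_toRow W]
    simp only [hΦ]
    congr 1
    funext v
    rw [hrepr v]
    have hb : ∀ b : Bool, decide ((if b = true then (1 : ZMod 2) else 0) = 1) = b := by decide
    congr 1 <;> funext u <;> exact hb _
  refine le_trans (Finset.card_le_card hsub) (le_trans Finset.card_image_le ?_)
  rw [Finset.card_product]
  have h := card_lowDeg_le M D L hL
  calc L.card * L.card ≤ 2 ^ monoCount M D * 2 ^ monoCount M D := Nat.mul_le_mul h h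
    _ = 4 ^ monoCount M D := by rw [← mul_pow]; norm_num

end CubeDistr

end Summit.QuantumAdvantage.AdviceFreeQNC0
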